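import Summits.Ventures.CertifiedManyBodySolver.Certificates.HubbardSquare_n9o10_tp1o4_thermal_axis_retype3x3_j273931
import Summits.Ventures.CertifiedManyBodySolver.Certificates.HubbardSquare_n9o8_tpm1o4_thermal_axis_PH_C2markov3x3_j273931
import Literature.MathematicalPhysics.QuantumLattice.TorusLimitParticleHoleWordPullback
import Literature.MathematicalPhysics.QuantumLattice.HubbardFermiSeaTangentRowsPositiveTPrime
import HarnessLib

/-!
# Ventures/CertifiedManyBodySolver — ELECTRON-DOPED cells at `(U, n, t′) = (8, 11/10, −1/4)` — M55 NCCO x = 0.10 (n_e = 1.10; also the NCCO #20 box interior) — `β ∈ {1/2, 1, 2, 3}`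
# and colder, by PARTICLE–HOLE from the retyped image cells at `(8, 9/10, +1/4)`

HONEST FRAMING: first certified bounds; not a superconductivity verdict; every number certified or labelled float.
WHAT THIS IS NOT: not a phase sentence; not of record until the mbsolver LEAD pen + referee sign; energy WINDOWS for the tree's THERMAL object of the
ELECTRON-DOPED `t–t'` model (torus limits of the canonical sector Gibbs states of `hubbardTorusTT' L 1 (-1/4) 8` on `N↑ = N↓ = ⌊(11/10)L²/2⌋`) along
`Ls → ∞` with `10 ∣ Ls j` eventually (complementary record sectors + even sides; flag «PH-transported, even-tori subsequence», cell ruling R-co);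
UPPER edges CONDITIONAL on the nodes named in `HubbardSquare_n9o10_tp1o4_thermal_axis_retype3x3_j273931` (p2's `cert_c2sector_tp1o4_3x3_<β>_j273931`,
eng-2's `cert_feC1_3x2_*`), LOWER edges kernel (Fermi-sea tangent row `fermiSeaTangentRow_tPrime_one_div_four_at_nine_div_ten` read at `n = 9/10` + particle–hole); no new certificate.
MECHANISM: image caps `e_{Φ(1,1/4,8)} ≤ X_β` over the canonical class at `(1, 1/4, 8, 9/10, β' ≥ β)` pull back by the instance form
`IsTorusLimitOfMixture.meanEnergy_le_of_forall_image_cap` (`s' = 1/4 = −(−1/4)`, `n' = 9/10 = 2 − 11/10`) to `e_{Φ(1,−1/4,8)}(ω) ≤ X_β + 8·(11/10 − 1)`.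
HENCE for every torus limit at `β' ≥ β` along `10 ∣ L`, 10-dp outward:
`β = 1/2` (T = 2t): `e ∈ [-0.8972549094, 1.2923221634]` · `β = 1` (T = t): `e ∈ [-0.8972549094, 0.8434888208]` · `β = 2` (T = t/2): `e ∈ [-0.8972549094, 0.5844049874]` · `β = 3` (T = t/3): `e ∈ [-0.8972549094, 0.4875194993]`.
Strength (upper edges) = the named nodes ∧ kernel theorems; retracted with any of them.
[cite: LiebWuPhysicaA2003, §1 eq. (3)] [cite: Israel1979, Lemma II.3.1] [cite: Lieb1973, §V (5.2)–(5.4)] [cite: PoulinHastings2011, eqs. (3)–(8)] [cite: Ruelle1969, §3.4]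
[cite: LiebLoss1993, §8, Theorem 8.2]
Seat prover-hubbard-downfold-unc-2-g8 (pub/hubbard-downfold, filling direction), 2026-08-27; zero solves, zero kit.
-/

noncomputable section

namespace Summit.Ventures.CertifiedManyBodySolver.Certificates

open Literature.MathematicalPhysics.QuantumLattice
open Literature.MathematicalPhysics.QuantumLattice.ThermodynamicLimit
open Literature.MathematicalPhysics.QuantumLattice.InfVolFermionState
open Literature.MathematicalPhysics.QuantumLattice.AndersonCluster
open Literature.Probability.LatticeModels
open _root_.Filter
open scoped ComplexOrder

/-- **Complementary record sectors at `n = 11/10 ↔ 9/10` along `10 ∣ L`**: `⌊(9/10)L²/2⌋ + ⌊(11/10)L²/2⌋ = L²`.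
[cite: LiebWuPhysicaA2003, §1 eq. (3)] -/
theorem halfRectN_compl_n11o10 {L : ℕ} (hL : 10 ∣ L) : halfRectN (9 / 10) L + halfRectN (11 / 10) L = L ^ 2 := by
  obtain ⟨k, rfl⟩ := hL
  have h := halfRectN_two_sub_add_of_eq (n := 11 / 10) (by norm_num) (L := 10 * k) (m := 55 * k ^ 2) (by push_cast; ring)
  rwa [show (2 - 11 / 10 : ℝ) = 9 / 10 by norm_num] at h

/-- **Electron-doped ground-state floor at `(t', n) = (−1/4, 11/10)`, every `U ≥ 0`**: `e(1, −1/4, U, 11/10) ≥ -1.6972549094 + U·(11/10 − 1)`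
(kernel Fermi-sea tangent row at the image point + particle–hole; no node). [cite: LiebLoss1993, §8, Theorem 8.2] [cite: LiebWuPhysicaA2003, §1 eq. (3)] -/
theorem ground_n11o10_tpm1o4_floor_PH {U : ℝ} (hU : 0 ≤ U) :
    (-1.6972549094 : ℝ) + U * (4 / 5 / 8) ≤ energyDensityTT' 1 (-1 / 4) U (11 / 10) := by
  have hrow := fermiSeaTangentRow_tPrime_one_div_four_at_nine_div_ten hU (n := 9 / 10) (by norm_num) (by norm_num)
  have himg : (-1.6972549094 : ℝ) ≤ energyDensityTT' 1 (-(-1 / 4)) U (2 - 11 / 10) := by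
    rw [show (-(-1 / 4) : ℝ) = 1 / 4 by norm_num, show (2 - 11 / 10 : ℝ) = 9 / 10 by norm_num]
    linarith
  have h := energyDensityTT'_ge_of_particleHole_image 1 (-1 / 4) hU (n := 11 / 10) (by norm_num) (by norm_num) himg
  linarith

/-- **LOWER EDGE** (every `β`, every `Ls`, every `U ≥ 0`; no node): `-1.6972549094 + U·(11/10 − 1) ≤ e(ω)` for every torus limit of the canonical
class at `(1, −1/4, U, 11/10, β)`. [cite: Ruelle1969, §3.4] [cite: LiebWuPhysicaA2003, §1 eq. (3)] -/
theorem thermal_n11o10_tpm1o4_lower {β U : ℝ} (hU : 0 ≤ U) {ω : InfVolFermionState 2} {Ls : ℕ → ℕ} (hLs : Tendsto Ls atTop atTop)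
    (h : ω.IsTorusLimitOfMixture (sectorGibbsCount (11 / 10)) (fun L => sectorGibbsWeightTT' β 1 (-1 / 4) U (11 / 10) L)
      (fun L => sectorGibbsVectorTT' 1 (-1 / 4) U (11 / 10) L) Ls) :
    (-1.6972549094 : ℝ) + U * (4 / 5 / 8) ≤ ω.meanEnergy (hubbardTTPrimeFermionInteraction 1 (-1 / 4) U) 1 :=
  (ground_n11o10_tpm1o4_floor_PH hU).trans
    (h.energyDensityTT'_le_meanEnergy_of_sectorGibbs 1 (-1 / 4) U (n := 11 / 10) (by norm_num) (by norm_num) β hLs (-1 / 4) hU)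

/-- **ELECTRON-DOPED cap at `(8, 11/10, −1/4)`, `β' ≥ 1/2`** (T = 2t and colder): `e_{Φ(1,−1/4,8)}(ω) ≤ 0.4923221634 + 4 / 5` (`≤ 1.2923221634` rounded up)
for every torus limit of the canonical class at `(1, −1/4, 8, 11/10, β')` along `Ls` with `10 ∣ Ls j` eventually (image cap + `8·(11/10 − 1)`).
Strength = C2(cert_c2sector_tp1o4_3x3_b1o2_j273931) ∧ C1(cert_feC1_3x2_b1o8_j263703) ∧ kernel theorems. [cite: LiebWuPhysicaA2003, §1 eq. (3)] [cite: Israel1979, Lemma II.3.1] -/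
theorem thermal_n11o10_tpm1o4_upper_b1o2_PH_of_le (hC2 : cert_c2sector_tp1o4_3x3_b1o2_j273931) (hC1 : cert_feC1_3x2_b1o8_j263703) {β : ℝ}
    (hle : (1 / 2 : ℝ) ≤ β) {ω : InfVolFermionState 2} {Ls : ℕ → ℕ} (hLs : Tendsto Ls atTop atTop) (hdiv : ∀ᶠ j in atTop, 10 ∣ Ls j)
    (h : ω.IsTorusLimitOfMixture (sectorGibbsCount (11 / 10)) (fun L => sectorGibbsWeightTT' β 1 (-1 / 4) 8 (11 / 10) L)
      (fun L => sectorGibbsVectorTT' 1 (-1 / 4) 8 (11 / 10) L) Ls) :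
    ω.meanEnergy (hubbardTTPrimeFermionInteraction 1 (-1 / 4) 8) 1 ≤ (0.4923221634 : ℝ) + 4 / 5 := by
  have heven : ∀ᶠ j in atTop, Even (Ls j) :=
    hdiv.mono fun j hj => even_iff_two_dvd.2 (dvd_trans (by norm_num) hj)
  have hadd : ∀ᶠ j in atTop, halfRectN (9 / 10) (Ls j) + halfRectN (11 / 10) (Ls j) = Ls j ^ 2 :=
    hdiv.mono fun j hj => halfRectN_compl_n11o10 hj
  have hmain := h.meanEnergy_le_of_forall_image_cap β 1 (-1 / 4) 8 (s' := 1 / 4) (n' := 9 / 10) (by norm_num) (by norm_num)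
    (by norm_num) (by norm_num) (fun Ls' ω' hLs' hω' => image_n9o10_tp1o4_upper_b1o2_of_le hC2 hC1 hle hLs' hω') hLs heven hadd
  linarith

/-- **ELECTRON-DOPED WINDOW at `(8, 11/10, −1/4)`, `β' ≥ 1/2`**: `e ∈ [-0.8972549094, 1.2923221634]` (lower edge kernel, upper edge conditional).
[cite: LiebWuPhysicaA2003, §1 eq. (3)] [cite: Ruelle1969, §3.4] -/
theorem thermal_n11o10_tpm1o4_window_b1o2_PH_of_le (hC2 : cert_c2sector_tp1o4_3x3_b1o2_j273931) (hC1 : cert_feC1_3x2_b1o8_j263703) {β : ℝ}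
    (hle : (1 / 2 : ℝ) ≤ β) {ω : InfVolFermionState 2} {Ls : ℕ → ℕ} (hLs : Tendsto Ls atTop atTop) (hdiv : ∀ᶠ j in atTop, 10 ∣ Ls j)
    (h : ω.IsTorusLimitOfMixture (sectorGibbsCount (11 / 10)) (fun L => sectorGibbsWeightTT' β 1 (-1 / 4) 8 (11 / 10) L)
      (fun L => sectorGibbsVectorTT' 1 (-1 / 4) 8 (11 / 10) L) Ls) :
    ω.meanEnergy (hubbardTTPrimeFermionInteraction 1 (-1 / 4) 8) 1 ∈ Set.Icc (-0.8972549094 : ℝ) 1.2923221634 := by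
  have hl := thermal_n11o10_tpm1o4_lower (U := 8) (by norm_num) hLs h
  have hu := thermal_n11o10_tpm1o4_upper_b1o2_PH_of_le hC2 hC1 hle hLs hdiv h
  exact ⟨by linarith, by linarith⟩

/-- **ELECTRON-DOPED cap at `(8, 11/10, −1/4)`, `β' ≥ 1`** (T = t and colder): `e_{Φ(1,−1/4,8)}(ω) ≤ 0.0434888208 + 4 / 5` (`≤ 0.8434888208` rounded up)
for every torus limit of the canonical class at `(1, −1/4, 8, 11/10, β')` along `Ls` with `10 ∣ Ls j` eventually (image cap + `8·(11/10 − 1)`).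
Strength = C2(cert_c2sector_tp1o4_3x3_b1_j273931) ∧ C1(cert_feC1_3x2_b1o4_j262363) ∧ kernel theorems. [cite: LiebWuPhysicaA2003, §1 eq. (3)] [cite: Israel1979, Lemma II.3.1] -/
theorem thermal_n11o10_tpm1o4_upper_b1_PH_of_le (hC2 : cert_c2sector_tp1o4_3x3_b1_j273931) (hC1 : cert_feC1_3x2_b1o4_j262363) {β : ℝ}
    (hle : (1 : ℝ) ≤ β) {ω : InfVolFermionState 2} {Ls : ℕ → ℕ} (hLs : Tendsto Ls atTop atTop) (hdiv : ∀ᶠ j in atTop, 10 ∣ Ls j)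
    (h : ω.IsTorusLimitOfMixture (sectorGibbsCount (11 / 10)) (fun L => sectorGibbsWeightTT' β 1 (-1 / 4) 8 (11 / 10) L)
      (fun L => sectorGibbsVectorTT' 1 (-1 / 4) 8 (11 / 10) L) Ls) :
    ω.meanEnergy (hubbardTTPrimeFermionInteraction 1 (-1 / 4) 8) 1 ≤ (0.0434888208 : ℝ) + 4 / 5 := by
  have heven : ∀ᶠ j in atTop, Even (Ls j) :=
    hdiv.mono fun j hj => even_iff_two_dvd.2 (dvd_trans (by norm_num) hj)
  have hadd : ∀ᶠ j in atTop, halfRectN (9 / 10) (Ls j) + halfRectN (11 / 10) (Ls j) = Ls j ^ 2 :=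
    hdiv.mono fun j hj => halfRectN_compl_n11o10 hj
  have hmain := h.meanEnergy_le_of_forall_image_cap β 1 (-1 / 4) 8 (s' := 1 / 4) (n' := 9 / 10) (by norm_num) (by norm_num)
    (by norm_num) (by norm_num) (fun Ls' ω' hLs' hω' => image_n9o10_tp1o4_upper_b1_of_le hC2 hC1 hle hLs' hω') hLs heven hadd
  linarith

/-- **ELECTRON-DOPED WINDOW at `(8, 11/10, −1/4)`, `β' ≥ 1`**: `e ∈ [-0.8972549094, 0.8434888208]` (lower edge kernel, upper edge conditional).
[cite: LiebWuPhysicaA2003, §1 eq. (3)] [cite: Ruelle1969, §3.4] -/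
theorem thermal_n11o10_tpm1o4_window_b1_PH_of_le (hC2 : cert_c2sector_tp1o4_3x3_b1_j273931) (hC1 : cert_feC1_3x2_b1o4_j262363) {β : ℝ}
    (hle : (1 : ℝ) ≤ β) {ω : InfVolFermionState 2} {Ls : ℕ → ℕ} (hLs : Tendsto Ls atTop atTop) (hdiv : ∀ᶠ j in atTop, 10 ∣ Ls j)
    (h : ω.IsTorusLimitOfMixture (sectorGibbsCount (11 / 10)) (fun L => sectorGibbsWeightTT' β 1 (-1 / 4) 8 (11 / 10) L)
      (fun L => sectorGibbsVectorTT' 1 (-1 / 4) 8 (11 / 10) L) Ls) :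
    ω.meanEnergy (hubbardTTPrimeFermionInteraction 1 (-1 / 4) 8) 1 ∈ Set.Icc (-0.8972549094 : ℝ) 0.8434888208 := by
  have hl := thermal_n11o10_tpm1o4_lower (U := 8) (by norm_num) hLs h
  have hu := thermal_n11o10_tpm1o4_upper_b1_PH_of_le hC2 hC1 hle hLs hdiv h
  exact ⟨by linarith, by linarith⟩

/-- **ELECTRON-DOPED cap at `(8, 11/10, −1/4)`, `β' ≥ 2`** (T = t/2 and colder): `e_{Φ(1,−1/4,8)}(ω) ≤ -0.2155950126 + 4 / 5` (`≤ 0.5844049874` rounded up)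
for every torus limit of the canonical class at `(1, −1/4, 8, 11/10, β')` along `Ls` with `10 ∣ Ls j` eventually (image cap + `8·(11/10 − 1)`).
Strength = C2(cert_c2sector_tp1o4_3x3_b2_j273931) ∧ C1(cert_feC1_3x2_b1o4_j262363) ∧ kernel theorems. [cite: LiebWuPhysicaA2003, §1 eq. (3)] [cite: Israel1979, Lemma II.3.1] -/
theorem thermal_n11o10_tpm1o4_upper_b2_PH_of_le (hC2 : cert_c2sector_tp1o4_3x3_b2_j273931) (hC1 : cert_feC1_3x2_b1o4_j262363) {β : ℝ}
    (hle : (2 : ℝ) ≤ β) {ω : InfVolFermionState 2} {Ls : ℕ → ℕ} (hLs : Tendsto Ls atTop atTop) (hdiv : ∀ᶠ j in atTop, 10 ∣ Ls j)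
    (h : ω.IsTorusLimitOfMixture (sectorGibbsCount (11 / 10)) (fun L => sectorGibbsWeightTT' β 1 (-1 / 4) 8 (11 / 10) L)
      (fun L => sectorGibbsVectorTT' 1 (-1 / 4) 8 (11 / 10) L) Ls) :
    ω.meanEnergy (hubbardTTPrimeFermionInteraction 1 (-1 / 4) 8) 1 ≤ (-0.2155950126 : ℝ) + 4 / 5 := by
  have heven : ∀ᶠ j in atTop, Even (Ls j) :=
    hdiv.mono fun j hj => even_iff_two_dvd.2 (dvd_trans (by norm_num) hj)
  have hadd : ∀ᶠ j in atTop, halfRectN (9 / 10) (Ls j) + halfRectN (11 / 10) (Ls j) = Ls j ^ 2 :=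
    hdiv.mono fun j hj => halfRectN_compl_n11o10 hj
  have hmain := h.meanEnergy_le_of_forall_image_cap β 1 (-1 / 4) 8 (s' := 1 / 4) (n' := 9 / 10) (by norm_num) (by norm_num)
    (by norm_num) (by norm_num) (fun Ls' ω' hLs' hω' => image_n9o10_tp1o4_upper_b2_of_le hC2 hC1 hle hLs' hω') hLs heven hadd
  linarith

/-- **ELECTRON-DOPED WINDOW at `(8, 11/10, −1/4)`, `β' ≥ 2`**: `e ∈ [-0.8972549094, 0.5844049874]` (lower edge kernel, upper edge conditional).
[cite: LiebWuPhysicaA2003, §1 eq. (3)] [cite: Ruelle1969, §3.4] -/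
theorem thermal_n11o10_tpm1o4_window_b2_PH_of_le (hC2 : cert_c2sector_tp1o4_3x3_b2_j273931) (hC1 : cert_feC1_3x2_b1o4_j262363) {β : ℝ}
    (hle : (2 : ℝ) ≤ β) {ω : InfVolFermionState 2} {Ls : ℕ → ℕ} (hLs : Tendsto Ls atTop atTop) (hdiv : ∀ᶠ j in atTop, 10 ∣ Ls j)
    (h : ω.IsTorusLimitOfMixture (sectorGibbsCount (11 / 10)) (fun L => sectorGibbsWeightTT' β 1 (-1 / 4) 8 (11 / 10) L)
      (fun L => sectorGibbsVectorTT' 1 (-1 / 4) 8 (11 / 10) L) Ls) :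
    ω.meanEnergy (hubbardTTPrimeFermionInteraction 1 (-1 / 4) 8) 1 ∈ Set.Icc (-0.8972549094 : ℝ) 0.5844049874 := by
  have hl := thermal_n11o10_tpm1o4_lower (U := 8) (by norm_num) hLs h
  have hu := thermal_n11o10_tpm1o4_upper_b2_PH_of_le hC2 hC1 hle hLs hdiv h
  exact ⟨by linarith, by linarith⟩

/-- **ELECTRON-DOPED cap at `(8, 11/10, −1/4)`, `β' ≥ 3`** (T = t/3 and colder): `e_{Φ(1,−1/4,8)}(ω) ≤ -0.3124805007 + 4 / 5` (`≤ 0.4875194993` rounded up)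
for every torus limit of the canonical class at `(1, −1/4, 8, 11/10, β')` along `Ls` with `10 ∣ Ls j` eventually (image cap + `8·(11/10 − 1)`).
Strength = C2(cert_c2sector_tp1o4_3x3_b3_j273931) ∧ C1(cert_feC1_3x2_b3o8_j263703) ∧ kernel theorems. [cite: LiebWuPhysicaA2003, §1 eq. (3)] [cite: Israel1979, Lemma II.3.1] -/
theorem thermal_n11o10_tpm1o4_upper_b3_PH_of_le (hC2 : cert_c2sector_tp1o4_3x3_b3_j273931) (hC1 : cert_feC1_3x2_b3o8_j263703) {β : ℝ}
    (hle : (3 : ℝ) ≤ β) {ω : InfVolFermionState 2} {Ls : ℕ → ℕ} (hLs : Tendsto Ls atTop atTop) (hdiv : ∀ᶠ j in atTop, 10 ∣ Ls j)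
    (h : ω.IsTorusLimitOfMixture (sectorGibbsCount (11 / 10)) (fun L => sectorGibbsWeightTT' β 1 (-1 / 4) 8 (11 / 10) L)
      (fun L => sectorGibbsVectorTT' 1 (-1 / 4) 8 (11 / 10) L) Ls) :
    ω.meanEnergy (hubbardTTPrimeFermionInteraction 1 (-1 / 4) 8) 1 ≤ (-0.3124805007 : ℝ) + 4 / 5 := by
  have heven : ∀ᶠ j in atTop, Even (Ls j) :=
    hdiv.mono fun j hj => even_iff_two_dvd.2 (dvd_trans (by norm_num) hj)
  have hadd : ∀ᶠ j in atTop, halfRectN (9 / 10) (Ls j) + halfRectN (11 / 10) (Ls j) = Ls j ^ 2 :=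
    hdiv.mono fun j hj => halfRectN_compl_n11o10 hj
  have hmain := h.meanEnergy_le_of_forall_image_cap β 1 (-1 / 4) 8 (s' := 1 / 4) (n' := 9 / 10) (by norm_num) (by norm_num)
    (by norm_num) (by norm_num) (fun Ls' ω' hLs' hω' => image_n9o10_tp1o4_upper_b3_of_le hC2 hC1 hle hLs' hω') hLs heven hadd
  linarith

/-- **ELECTRON-DOPED WINDOW at `(8, 11/10, −1/4)`, `β' ≥ 3`**: `e ∈ [-0.8972549094, 0.4875194993]` (lower edge kernel, upper edge conditional).
[cite: LiebWuPhysicaA2003, §1 eq. (3)] [cite: Ruelle1969, §3.4] -/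
theorem thermal_n11o10_tpm1o4_window_b3_PH_of_le (hC2 : cert_c2sector_tp1o4_3x3_b3_j273931) (hC1 : cert_feC1_3x2_b3o8_j263703) {β : ℝ}
    (hle : (3 : ℝ) ≤ β) {ω : InfVolFermionState 2} {Ls : ℕ → ℕ} (hLs : Tendsto Ls atTop atTop) (hdiv : ∀ᶠ j in atTop, 10 ∣ Ls j)
    (h : ω.IsTorusLimitOfMixture (sectorGibbsCount (11 / 10)) (fun L => sectorGibbsWeightTT' β 1 (-1 / 4) 8 (11 / 10) L)
      (fun L => sectorGibbsVectorTT' 1 (-1 / 4) 8 (11 / 10) L) Ls) :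
    ω.meanEnergy (hubbardTTPrimeFermionInteraction 1 (-1 / 4) 8) 1 ∈ Set.Icc (-0.8972549094 : ℝ) 0.4875194993 := by
  have hl := thermal_n11o10_tpm1o4_lower (U := 8) (by norm_num) hLs h
  have hu := thermal_n11o10_tpm1o4_upper_b3_PH_of_le hC2 hC1 hle hLs hdiv h
  exact ⟨by linarith, by linarith⟩

end Summit.Ventures.CertifiedManyBodySolver.Certificates

end
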